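import Literature.NumberTheory.EllipticCurves.IwasawaAlgebraLengthAwayComparisonProofs
import Literature.NumberTheory.EllipticCurves.IwasawaAlgebraSemilinearCharIdealProofs
import Literature.NumberTheory.EllipticCurves.IwasawaAlgebraRankOneIdealProofs
import Literature.NumberTheory.EllipticCurves.IwasawaAlgebraStructureProofs
import HarnessLib

/-!
# A module killed by a prime element `f` and by some `g` with `f ∤ g` is PSEUDO-NULL; hence `(f, g)·A ⊆ B ⟹ char(N/B) = char(N/(A + B))`
# — the «height-two pair» criterion of de Shalit II §4.12 / III Lemma 1.10, for any Noetherian domain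

Generic commutative algebra (everything PROVED, nothing assumed).  Over a Noetherian domain `R`: a height-one prime containing a PRIME ELEMENT `f` is
`(f)` itself (the tree's `Ideal.eq_span_singleton_of_height_eq_one`), so if `f ∤ g` then no prime of height `≤ 1` contains both `f` and `g`; by the pointwise
criterion (`Module.isPseudoNull_iff`) every module killed by `f` and `g` is pseudo-null, and such submodule-quotients do not change characteristic ideals
(`charIdeal_quotient_mul_charIdeal_quotient_map`, `charIdeal_eq_top_of_isPseudoNull`).  de Shalit III Lemma 1.10: "any noetherian module annihilated by
two relatively prime elements is pseudo-null".

* ★ `Module.exists_mem_span_pair_not_mem_of_prime_of_not_dvd` — `(f, g) ⊄ 𝔭` for every prime `𝔭` of height `≤ 1`;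
* ★ `Module.isPseudoNull_of_isTorsionBy_prime_of_not_dvd` — `f·M = 0`, `g·M = 0`, `f` prime, `f ∤ g` ⟹ `M` pseudo-null;
* ★★ `Module.charIdeal_quotient_eq_of_prime_pair_smul_le` — `f·A ⊆ B`, `g·A ⊆ B` ⟹ **`char(N/B) = char(N/(A ⊔ B))`** (`N/B` finitely generated torsion),
  and `Module.charIdeal_quotient_eq_of_prime_pair_smul_le_of_le` for any `A′ ≤ A ⊔ B` in between.

USE (cell `bsd-print-cf2`, width seat `bsd-line-cf2c-w7` g24, brick §4(c), item D4 case (β) of `Cruxes/TwoVariableMainConjAtSplitTwoQuad/BRICK-C-ITEMS-g24.md`):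
in the Coleman lane's `Λ = 𝒪⟦X⟧⟦T⟧` the liftable Artin elements give `f = t_{𝔞₁} − N𝔞₁ = w·(T − b)` (prime: `Λ/(T − b) ≅ 𝒪⟦X⟧`,
`LubinTate.ker_tEvalHom_eq_span`) and `g = t_{𝔞₂} − N𝔞₂` with `g(b) ≠ 0` (`maxEval_twistFactor_ne_zero_*`, i.e. `f ∤ g` by `X_sub_C_dvd_iff_tEval_eq_zero`);
Kato's relation `(σ_𝔞 − N𝔞)·Θ(·, 𝔤′) = (σ_{𝔤′} − N𝔤′)·Θ(·, 𝔞)` (`EllipticUnitsLocalRelation.artin_mul_pow_eq`) puts `(f, g)·⟨Θ(·, 𝔤′)⟩` inside the span of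
the LIFTABLE units, so the units with non-liftable twist `𝔤′` do not change `char`.  Over `Λ₂ = ℤ_p⟦T₁,T₂⟧` with `f = T₁`, `g = T₂` this is the
augmentation case (`PrintCf2RubinValueTwoCharIdealAugmentationInsensitive`, p813804).  `--supports` crux stmt-BirchSwinnertonDyer-24033.  BSD is not
advanced by this file.

References: E. de Shalit, *Iwasawa theory of elliptic curves with complex multiplication* (1987), II §4.12 (29)–(32), III Lemma 1.10; N. Bourbaki,
*Algèbre commutative* VII §4.5; J. Neukirch, A. Schmidt, K. Wingberg, *Cohomology of Number Fields* (2nd ed.) Ch. V §1 (5.1.4)–(5.1.6).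
-/

noncomputable section

namespace Literature.NumberTheory.EllipticCurves

namespace Module

variable {R : Type*} [CommRing R] [IsNoetherianRing R] [IsDomain R]
  {M : Type*} [AddCommGroup M] [_root_.Module R M]
  {N : Type*} [AddCommGroup N] [_root_.Module R N]

/-! ### `(f, g)` lies in no prime of height `≤ 1` -/

omit [IsNoetherianRing R] in
/-- ★ **`(f, g) ⊄ 𝔭` for `𝔭` of height `≤ 1`, `f` a prime element, `f ∤ g`**: if `f ∈ 𝔭` then `𝔭 ≠ 0` has height one and is `(f)`, which misses `g`.
[cite: deShalit1987, III Lemma 1.10 (p. 95)] [cite: NeukirchSchmidtWingberg2008, Ch. V §1 (5.1.4)–(5.1.6)] -/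
theorem exists_mem_span_pair_not_mem_of_prime_of_not_dvd {f g : R} (hf : Prime f) (hfg : ¬ f ∣ g)
    (𝔭 : PrimeSpectrum R) (h𝔭 : 𝔭.asIdeal.height ≤ 1) : ∃ r ∈ Ideal.span {f, g}, r ∉ 𝔭.asIdeal := by
  by_cases hf𝔭 : f ∈ 𝔭.asIdeal
  · refine ⟨g, Ideal.subset_span (by simp), fun hg𝔭 ↦ hfg ?_⟩
    have h0 : 𝔭.asIdeal ≠ ⊥ := fun h0 ↦ hf.ne_zero (by rw [h0, Ideal.mem_bot] at hf𝔭; exact hf𝔭)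
    have h1 : 𝔭.asIdeal.height = 1 :=
      le_antisymm h𝔭 (Order.one_le_iff_ne_zero.mpr (by rwa [Ne, Ideal.height_eq_zero_iff_eq_bot]))
    have h𝔭f : 𝔭.asIdeal = Ideal.span {f} := Ideal.eq_span_singleton_of_height_eq_one h1 hf𝔭 hf
    rw [h𝔭f, Ideal.mem_span_singleton] at hg𝔭
    exact hg𝔭
  · exact ⟨f, Ideal.subset_span (by simp), hf𝔭⟩

/-! ### Pseudo-nullity -/

omit [IsNoetherianRing R] in
/-- ★ **A module killed by a prime element `f` and by `g` with `f ∤ g` is pseudo-null** ("annihilated by two relatively prime elements").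
[cite: deShalit1987, III Lemma 1.10 (p. 95)] [cite: BourbakiAC5to7, Ch. VII §4 no. 5] -/
theorem isPseudoNull_of_isTorsionBy_prime_of_not_dvd {f g : R} (hf : Prime f) (hfg : ¬ f ∣ g)
    (hMf : Module.IsTorsionBy R M f) (hMg : Module.IsTorsionBy R M g) : IsPseudoNull R M := by
  rw [isPseudoNull_iff]
  intro 𝔭 h𝔭 m
  obtain ⟨r, hr, hr𝔭⟩ := exists_mem_span_pair_not_mem_of_prime_of_not_dvd hf hfg 𝔭 h𝔭
  refine ⟨r, hr𝔭, ?_⟩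
  obtain ⟨a, b, rfl⟩ := Ideal.mem_span_pair.mp hr
  rw [add_smul, mul_smul, mul_smul, @hMf m, @hMg m, smul_zero, smul_zero, add_zero]

omit [IsNoetherianRing R] [IsDomain R] in
/-- The class in `N ⧸ B` of an element of `A ⊔ B` is the class of an element of `A`. [folklore] -/
private theorem exists_mem_mkQ_eq_of_mem_sup' (A B : Submodule R N) {y : N} (hy : y ∈ A ⊔ B) :
    ∃ a ∈ A, B.mkQ a = B.mkQ y := by
  obtain ⟨a, ha, b, hb, rfl⟩ := Submodule.mem_sup.mp hy
  refine ⟨a, ha, ?_⟩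
  have hb0 : B.mkQ b = 0 := (Submodule.Quotient.mk_eq_zero B).mpr hb
  rw [map_add, hb0, add_zero]

omit [IsNoetherianRing R] [IsDomain R] in
/-- If `s·A ⊆ B` then `(A ⊔ B) ⧸ B` (`(A ⊔ B).map B.mkQ`) is killed by `s`. [cite: BourbakiAC5to7, Ch. VII §4 no. 5] -/
theorem isTorsionBy_map_mkQ_sup_of_smul_mem (A B : Submodule R N) {s : R} (h : ∀ a ∈ A, s • a ∈ B) :
    Module.IsTorsionBy R ↥((A ⊔ B).map B.mkQ) s := by
  intro x
  obtain ⟨y, hy, hxy⟩ := Submodule.mem_map.mp x.2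
  obtain ⟨a, ha, hay⟩ := exists_mem_mkQ_eq_of_mem_sup' A B hy
  apply Subtype.ext
  rw [Submodule.coe_smul, ← hxy, ← hay, ← map_smul, Submodule.coe_zero, Submodule.mkQ_apply, Submodule.Quotient.mk_eq_zero]
  exact h a ha

/-! ### Characteristic ideals -/

/-- ★★ **`char(N ⧸ B) = char(N ⧸ (A ⊔ B))` when `f·A ⊆ B` and `g·A ⊆ B`** for a prime element `f` and `g` with `f ∤ g` (`N ⧸ B` finitely generated
torsion): `(A ⊔ B)/B` is pseudo-null.  [cite: deShalit1987, III §1.4 (5), Lemma 1.10] [cite: BourbakiAC5to7, Ch. VII §4 no. 5] -/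
theorem charIdeal_quotient_eq_of_prime_pair_smul_le (A B : Submodule R N) [Module.Finite R (N ⧸ B)] (hB : Module.IsTorsion R (N ⧸ B))
    {f g : R} (hf : Prime f) (hfg : ¬ f ∣ g) (hfA : ∀ a ∈ A, f • a ∈ B) (hgA : ∀ a ∈ A, g • a ∈ B) :
    charIdeal R (N ⧸ B) = charIdeal R (N ⧸ (A ⊔ B)) := by
  rw [← charIdeal_quotient_mul_charIdeal_quotient_map B (A ⊔ B) le_sup_right hB,
    charIdeal_eq_top_of_isPseudoNull (isPseudoNull_of_isTorsionBy_prime_of_not_dvd hf hfg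
      (isTorsionBy_map_mkQ_sup_of_smul_mem A B hfA) (isTorsionBy_map_mkQ_sup_of_smul_mem A B hgA)), Ideal.top_mul]

/-- **Intermediate submodules**: under the same hypotheses `char(N ⧸ B) = char(N ⧸ (A′ ⊔ B))` for every `A′ ≤ A ⊔ B`.
[cite: deShalit1987, III §1.4 (5), Lemma 1.10] [cite: BourbakiAC5to7, Ch. VII §4 no. 5] -/
theorem charIdeal_quotient_eq_of_prime_pair_smul_le_of_le (A A' B : Submodule R N) [Module.Finite R (N ⧸ B)]
    (hB : Module.IsTorsion R (N ⧸ B)) {f g : R} (hf : Prime f) (hfg : ¬ f ∣ g)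
    (hfA : ∀ a ∈ A, f • a ∈ B) (hgA : ∀ a ∈ A, g • a ∈ B) (hA' : A' ≤ A ⊔ B) :
    charIdeal R (N ⧸ B) = charIdeal R (N ⧸ (A' ⊔ B)) := by
  have h₁ : B ≤ A' ⊔ B := le_sup_right
  have h₂ : A' ⊔ B ≤ A ⊔ B := sup_le hA' le_sup_right
  haveI : Module.Finite R (N ⧸ (A' ⊔ B)) := Module.Finite.of_surjective (Submodule.factor h₁) (Submodule.factor_surjective h₁)
  have hB' : Module.IsTorsion R (N ⧸ (A' ⊔ B)) := fun x ↦ by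
    obtain ⟨y, rfl⟩ := Submodule.factor_surjective h₁ x
    obtain ⟨r, hr⟩ := @hB y
    refine ⟨r, ?_⟩
    rw [Submonoid.smul_def, ← map_smul, ← Submonoid.smul_def, hr, map_zero]
  refine le_antisymm (charIdeal_quotient_mono B (A' ⊔ B) h₁ hB) ?_
  rw [charIdeal_quotient_eq_of_prime_pair_smul_le A B hB hf hfg hfA hgA]
  exact charIdeal_quotient_mono (A' ⊔ B) (A ⊔ B) h₂ hB'

end Module

end Literature.NumberTheory.EllipticCurves
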